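/-
Cell b2b-lgcu-borel (gen 21).  VALUE = THEOREM (a structural law on every hypothetical witness of
the crux), NOT summit progress; the crux item `SubgroupIdentityDesigns`
(stmt-MatrixMultiplication-14079) stays open and untouched.
-/
import Mathlib
import Summits.MatrixMultiplication.MatrixMultiplication.Theorems.SubgroupIdentityDesigns.Negative.FreeModuleLaw

/-!
# The twisted module law: Neumann probes in the `σ`-equivariants of the test space

Route `LevelGradedCohnUmans`, crux `SubgroupIdentityDesigns` (stmt-MatrixMultiplication-14079),
negative side; report `run/shared/lean/b2b/levelgraded-cu/ORACLE-g21.md` §G21-1.  VALUE = THEOREM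
(an all-`(G, J)` law on hypothetical witnesses; the CHARACTER refinement of the free-module law
`FreeModuleLaw`), NOT summit progress; the crux item is untouched and remains open.

## The law (abstract form, any finite group)

Let `J ≤ ℂ^G` be bi-invariant, `(H₁, H₂, H₃)` subgroup-TPP and `f ∈ J` an identity test
(`f 1 = 1`, `f (a b c) = 0` for `a b c ≠ 1`).  The Neumann probes `h ↦ f (u⁻¹ h r⁻¹)`
(`u ∈ H₁ ∪ (H₂ ∖ 1)`, `r ∈ H₃`) are linearly independent and are permuted FREELY by the right
translations of `H₃`; so `J|_{H₃} ⊇ (|H₁| + |H₂| − 1) · ℂ[H₃]` as a right `H₃`-module, and for every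
subgroup `K ≤ H₃` and every LINEAR CHARACTER `σ : K → ℂˣ`

  `(|H₁| + |H₂| − 1) · [H₃ : K] ≤ dim J_σ`,  `J_σ = {f ∈ J | f (g k) = σ(k) f g ∀ k ∈ K}`

(`index_mul_le_finrank_eqvRight`; `σ = 1` is the free-module law
`FreeModuleLaw.index_mul_le_finrank_invRight`, see `eqvRight_one`).  Proof: TWIST the periodised
probes — `h ↦ Σ_{k ∈ K} σ(k) f (u⁻¹ h k⁻¹ r⁻¹)` is `σ`-equivariant, lies in `J`, and its values at
the points `u' r'` (`r, r'` coset representatives of `H₃ / K`) are read off by the TPP exactly as in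
the untwisted case (`FreeModuleLaw.idTest_rep`: only `k = 1` survives, with weight `σ(1) = 1`), so
the block-triangular count `card_add_card_le_finrank` applies to `J_σ`.

Why it matters (level one, `J = F_1`): `|K| · dim (F_1)^K` counts ALL `K`-orbits on vectors
(`LevelOneInvariantDim`), so the invariant law is vacuous for subgroups rich in fixed points (tori,
monomial and affine groups) — the regime complementary to the semiregular law of gen 20.  The
twisted space `(F_1)_σ` only sees the orbits whose stabilisers lie in `ker σ`
(`LevelOneEquivariantDim`), and a well-chosen `σ` discards the fixed-point-rich orbits
(`CharacterLaw`, ORACLE-g21 §G21-2/3).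

## Also here

* `tpp_drop_middle`, `test_drop_middle` — the degenerate triple `(H₁, 1, H₂)` inherits the TPP and
  the identity test, so the law also binds the MIDDLE member: `|H₁| · [H₂ : K] ≤ dim J_σ` for
  `K ≤ H₂` (`card_mul_index_le_finrank_eqvRight_middle`).
* Crux forms at every level `k`: `crux_twisted_right(')`, `crux_twisted_middle(')`.

Sorry-free; standard axioms.
-/

set_option linter.dupNamespace false

noncomputable section

open scoped BigOperators Classical Matrix
open Module (finrank)

namespace Summit.MatrixMultiplication.MatrixMultiplication.Theorems.SubgroupIdentityDesigns.Negative
namespace TwistedModuleLaw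

open Literature.Barriers.MatrixMultiplication (SubgroupTPP)
open FreeModuleLaw (invRight mem_invRight card_mul_relIndex idTest_rep)

section Abstract

variable {G : Type} [Group G]

/-- The right `σ`-equivariant part `J_σ = {f ∈ J | f (g k) = σ(k) · f g, k ∈ K}` of a test space
`J ≤ ℂ^G`, for a linear character `σ : K →* ℂˣ` of a subgroup `K`. -/
def eqvRight (K : Subgroup G) (σ : K →* ℂˣ) (J : Submodule ℂ (G → ℂ)) : Submodule ℂ (G → ℂ) where
  carrier := {f | f ∈ J ∧ ∀ k : K, ∀ g : G, f (g * k) = (σ k : ℂ) * f g}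
  add_mem' := by
    rintro f f' ⟨hf, hfi⟩ ⟨hf', hfi'⟩
    exact ⟨J.add_mem hf hf', fun k g => by simp only [Pi.add_apply, hfi k g, hfi' k g, mul_add]⟩
  zero_mem' := ⟨J.zero_mem, fun _ _ => by simp⟩
  smul_mem' := by
    rintro c f ⟨hf, hfi⟩
    exact ⟨J.smul_mem c hf, fun k g => by simp only [Pi.smul_apply, hfi k g, smul_eq_mul]; ring⟩

/-- Membership in `J_σ`. -/
theorem mem_eqvRight {K : Subgroup G} {σ : K →* ℂˣ} {J : Submodule ℂ (G → ℂ)} {f : G → ℂ} :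
    f ∈ eqvRight K σ J ↔ f ∈ J ∧ ∀ k : K, ∀ g : G, f (g * k) = (σ k : ℂ) * f g := Iff.rfl

/-- `J_σ ≤ J`. -/
theorem eqvRight_le (K : Subgroup G) (σ : K →* ℂˣ) (J : Submodule ℂ (G → ℂ)) :
    eqvRight K σ J ≤ J := fun _ h => h.1

/-- For the trivial character the equivariants are the invariants: `J_1 = J^K`. -/
theorem eqvRight_one (K : Subgroup G) (J : Submodule ℂ (G → ℂ)) :
    eqvRight K 1 J = invRight K J := by
  ext f
  rw [mem_eqvRight, mem_invRight]
  simp only [MonoidHom.one_apply, Units.val_one, one_mul]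
  exact ⟨fun ⟨hf, h⟩ => ⟨hf, fun k hk g => h ⟨k, hk⟩ g⟩, fun ⟨hf, h⟩ => ⟨hf, fun k g => h k k.2 g⟩⟩

/-- Dropping the middle member: `(H₁, H₂, H₃)` TPP ⟹ `(H₁, 1, H₂)` TPP (any group). -/
theorem tpp_drop_middle {H₁ H₂ H₃ : Subgroup G} (h : SubgroupTPP H₁ H₂ H₃) :
    SubgroupTPP H₁ ⊥ H₂ := by
  intro a ha e he b hb habc
  rw [Subgroup.mem_bot] at he
  subst he
  obtain ⟨ha1, hb1, -⟩ := h a ha b hb 1 H₃.one_mem (by simpa using habc)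
  exact ⟨ha1, rfl, hb1⟩

/-- Dropping the middle member in an identity test: `f` vanishes on `H₁ · 1 · H₂ ∖ 1`. -/
theorem test_drop_middle {H₁ H₂ H₃ : Subgroup G} {f : G → ℂ}
    (h0 : ∀ a ∈ H₁, ∀ b ∈ H₂, ∀ c ∈ H₃, a * b * c ≠ 1 → f (a * b * c) = 0) :
    ∀ a ∈ H₁, ∀ e ∈ (⊥ : Subgroup G), ∀ b ∈ H₂, a * e * b ≠ 1 → f (a * e * b) = 0 := by
  intro a ha e he b hb hne
  rw [Subgroup.mem_bot] at he
  subst he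
  have h := h0 a ha b hb 1 H₃.one_mem (by simpa using hne)
  simpa using h

variable [Fintype G]

/-- The TWISTED periodised probe `h ↦ Σ_{k ∈ K} σ(k) f (u⁻¹ h k⁻¹ r⁻¹)` of a function `f` of a
bi-invariant space `J` lies in `J_σ`. -/
theorem probe_mem_eqvRight (J : Submodule ℂ (G → ℂ))
    (hJ : ∀ f ∈ J, ∀ s t : G, (fun g => f (s * g * t)) ∈ J) (K : Subgroup G) (σ : K →* ℂˣ)
    {f : G → ℂ} (hf : f ∈ J) (u r : G) :
    (fun h => ∑ k : K, (σ k : ℂ) * f (u⁻¹ * h * ((k : G)⁻¹ * r⁻¹))) ∈ eqvRight K σ J := by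
  refine ⟨?_, fun k₀ h => ?_⟩
  · have hfun : (fun h => ∑ k : K, (σ k : ℂ) * f (u⁻¹ * h * ((k : G)⁻¹ * r⁻¹))) =
        ∑ k : K, ((σ k : ℂ) • fun h => f (u⁻¹ * h * ((k : G)⁻¹ * r⁻¹))) := by
      ext h; simp [Finset.sum_apply]
    rw [hfun]
    exact Submodule.sum_mem _ fun k _ => J.smul_mem _ (hJ f hf _ _)
  · -- reindex `k ↦ k k₀⁻¹`
    show (∑ k : K, (σ k : ℂ) * f (u⁻¹ * (h * k₀) * ((k : G)⁻¹ * r⁻¹))) =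
      (σ k₀ : ℂ) * ∑ k : K, (σ k : ℂ) * f (u⁻¹ * h * ((k : G)⁻¹ * r⁻¹))
    rw [Finset.mul_sum]
    refine Fintype.sum_equiv (Equiv.mulRight k₀⁻¹) _ _ fun k => ?_
    have hne : ((σ k₀ : ℂˣ) : ℂ) ≠ 0 := (σ k₀).ne_zero
    have hσ : ∀ t : ℂ, ((σ k₀ : ℂˣ) : ℂ) * (((σ (k * k₀⁻¹) : ℂˣ) : ℂ) * t) =
        ((σ k : ℂˣ) : ℂ) * t := fun t => by
      rw [← mul_assoc, map_mul, map_inv, Units.val_mul, Units.val_inv_eq_inv_val,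
        mul_comm ((σ k : ℂˣ) : ℂ), ← mul_assoc, mul_inv_cancel₀ hne, one_mul]
    simp only [Equiv.coe_mulRight]
    rw [hσ]
    have harg : u⁻¹ * (h * (k₀ : G)) * ((k : G)⁻¹ * r⁻¹) =
        u⁻¹ * h * ((((k * k₀⁻¹ : K) : K) : G)⁻¹ * r⁻¹) := by
      simp only [Subgroup.coe_mul, Subgroup.coe_inv, mul_inv_rev, inv_inv, mul_assoc]
    rw [harg]

/-- Evaluation of the `σ`-weighted delta: `Σ_k σ(k) · [k = 1] = σ(1) = 1`. -/
theorem sum_sigma_mul_ite_eq_one {K : Subgroup G} (σ : K →* ℂˣ) :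
    (∑ k : K, (σ k : ℂ) * if k = 1 then (1 : ℂ) else 0) = 1 := by
  simp only [mul_ite, mul_one, mul_zero, Finset.sum_ite_eq', Finset.mem_univ, if_true, map_one,
    Units.val_one]

/-- **THE TWISTED MODULE LAW (abstract, right form).**  For a bi-invariant test space `J ≤ ℂ^G`,
a subgroup-TPP triple `(H₁, H₂, H₃)` carrying an identity test `f ∈ J`, every subgroup `K ≤ H₃`
and every linear character `σ : K →* ℂˣ`: `(|H₁| + |H₂| − 1) · [H₃ : K] ≤ dim J_σ`. -/
theorem index_mul_le_finrank_eqvRight (J : Submodule ℂ (G → ℂ))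
    (hJ : ∀ f ∈ J, ∀ s t : G, (fun g => f (s * g * t)) ∈ J)
    {H₁ H₂ H₃ : Subgroup G} (htpp : SubgroupTPP H₁ H₂ H₃)
    {f : G → ℂ} (hf : f ∈ J) (h1 : f 1 = 1)
    (h0 : ∀ a ∈ H₁, ∀ b ∈ H₂, ∀ c ∈ H₃, a * b * c ≠ 1 → f (a * b * c) = 0)
    {K : Subgroup G} (hK : K ≤ H₃) (σ : K →* ℂˣ) :
    (Nat.card H₁ + (Nat.card H₂ - 1)) * K.relIndex H₃ ≤ finrank ℂ (eqvRight K σ J) := by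
  classical
  let Q := H₃ ⧸ K.subgroupOf H₃
  let ρ : Q → G := fun q => ((q.out : H₃) : G)
  let S₂ := {b : H₂ // b ≠ 1}
  have hS₂ : Fintype.card S₂ = Nat.card H₂ - 1 := by
    simp only [S₂, Fintype.card_subtype_compl, Fintype.card_unique, Nat.card_eq_fintype_card]
  have h := LevelTwoBeatsCubes.Negative.card_add_card_le_finrank (A := H₁ × Q) (S := S₂ × Q)
    (eqvRight K σ J) (fun a => (a.1 : G) * ρ a.2) (fun s => ((s.1 : H₂) : G) * ρ s.2) ?_ ?_
  · rw [Fintype.card_prod, Fintype.card_prod, hS₂, ← Nat.card_eq_fintype_card (α := H₁),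
      ← add_mul] at h
    have hQ : Fintype.card Q = K.relIndex H₃ := by
      rw [← Nat.card_eq_fintype_card]; rfl
    rwa [hQ] at h
  · -- twisted probes for the points `a · ρ q`
    rintro ⟨a, q⟩
    refine ⟨_, probe_mem_eqvRight J hJ K σ hf (a : G) (ρ q), ?_, ?_, ?_⟩
    · show (∑ k : K, (σ k : ℂ) * f ((a : G)⁻¹ * ((a : G) * ρ q) * ((k : G)⁻¹ * (ρ q)⁻¹))) = 1
      have hterm : ∀ k : K, f ((a : G)⁻¹ * ((a : G) * ρ q) * ((k : G)⁻¹ * (ρ q)⁻¹)) =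
          if (1 : G) = 1 ∧ (1 : G) = 1 ∧ q = q ∧ k = 1 then 1 else 0 := fun k => by
        rw [← idTest_rep htpp h1 h0 hK q q H₁.one_mem H₂.one_mem k]
        congr 1; simp [ρ]
      simp only [hterm, true_and, sum_sigma_mul_ite_eq_one]
    · rintro ⟨a', q'⟩ hne
      show (∑ k : K, (σ k : ℂ) * f ((a : G)⁻¹ * ((a' : G) * ρ q') * ((k : G)⁻¹ * (ρ q)⁻¹))) = 0
      refine Finset.sum_eq_zero fun k _ => ?_
      have hx : (a : G)⁻¹ * (a' : G) ∈ H₁ := H₁.mul_mem (H₁.inv_mem a.2) a'.2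
      have e : (a : G)⁻¹ * ((a' : G) * ρ q') * ((k : G)⁻¹ * (ρ q)⁻¹) =
          (a : G)⁻¹ * (a' : G) * 1 * (ρ q' * ((k : G)⁻¹ * (ρ q)⁻¹)) := by simp [ρ, mul_assoc]
      rw [e, idTest_rep htpp h1 h0 hK q q' hx H₂.one_mem k, if_neg, mul_zero]
      rintro ⟨haa, -, hqq, -⟩
      apply hne
      have : a = a' := Subtype.ext (inv_mul_eq_one.1 haa)
      rw [this, hqq]
    · rintro ⟨b, q'⟩
      show (∑ k : K, (σ k : ℂ) * f ((a : G)⁻¹ * (((b : H₂) : G) * ρ q') *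
        ((k : G)⁻¹ * (ρ q)⁻¹))) = 0
      refine Finset.sum_eq_zero fun k _ => ?_
      have e : (a : G)⁻¹ * (((b : H₂) : G) * ρ q') * ((k : G)⁻¹ * (ρ q)⁻¹) =
          (a : G)⁻¹ * ((b : H₂) : G) * (ρ q' * ((k : G)⁻¹ * (ρ q)⁻¹)) := by simp [ρ, mul_assoc]
      rw [e, idTest_rep htpp h1 h0 hK q q' (H₁.inv_mem a.2) (b : H₂).2 k, if_neg, mul_zero]
      rintro ⟨-, hb, -⟩
      exact b.2 (Subtype.ext hb)
  · -- twisted probes for the points `b · ρ q`, `b ∈ H₂ ∖ 1`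
    rintro ⟨b, q⟩
    refine ⟨_, probe_mem_eqvRight J hJ K σ hf ((b : H₂) : G) (ρ q), ?_, ?_⟩
    · show (∑ k : K, (σ k : ℂ) * f (((b : H₂) : G)⁻¹ * (((b : H₂) : G) * ρ q) *
        ((k : G)⁻¹ * (ρ q)⁻¹))) = 1
      have hterm : ∀ k : K,
          f (((b : H₂) : G)⁻¹ * (((b : H₂) : G) * ρ q) * ((k : G)⁻¹ * (ρ q)⁻¹)) =
            if (1 : G) = 1 ∧ (1 : G) = 1 ∧ q = q ∧ k = 1 then 1 else 0 := fun k => by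
        rw [← idTest_rep htpp h1 h0 hK q q H₁.one_mem H₂.one_mem k]
        congr 1; simp [ρ]
      simp only [hterm, true_and, sum_sigma_mul_ite_eq_one]
    · rintro ⟨b', q'⟩ hne
      show (∑ k : K, (σ k : ℂ) * f (((b : H₂) : G)⁻¹ * (((b' : H₂) : G) * ρ q') *
        ((k : G)⁻¹ * (ρ q)⁻¹))) = 0
      refine Finset.sum_eq_zero fun k _ => ?_
      have hy : ((b : H₂) : G)⁻¹ * ((b' : H₂) : G) ∈ H₂ :=
        H₂.mul_mem (H₂.inv_mem (b : H₂).2) (b' : H₂).2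
      have e : ((b : H₂) : G)⁻¹ * (((b' : H₂) : G) * ρ q') * ((k : G)⁻¹ * (ρ q)⁻¹) =
          1 * (((b : H₂) : G)⁻¹ * ((b' : H₂) : G)) * (ρ q' * ((k : G)⁻¹ * (ρ q)⁻¹)) := by
        simp [ρ, mul_assoc]
      rw [e, idTest_rep htpp h1 h0 hK q q' H₁.one_mem hy k, if_neg, mul_zero]
      rintro ⟨-, hbb, hqq, -⟩
      apply hne
      have : b = b' := Subtype.ext (Subtype.ext (inv_mul_eq_one.1 hbb))
      rw [this, hqq]

/-- **Twisted module law, multiplied out:** `(|H₁| + |H₂| − 1) · |H₃| ≤ |K| · dim J_σ`. -/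
theorem card_mul_le_card_mul_finrank_eqvRight (J : Submodule ℂ (G → ℂ))
    (hJ : ∀ f ∈ J, ∀ s t : G, (fun g => f (s * g * t)) ∈ J)
    {H₁ H₂ H₃ : Subgroup G} (htpp : SubgroupTPP H₁ H₂ H₃)
    {f : G → ℂ} (hf : f ∈ J) (h1 : f 1 = 1)
    (h0 : ∀ a ∈ H₁, ∀ b ∈ H₂, ∀ c ∈ H₃, a * b * c ≠ 1 → f (a * b * c) = 0)
    {K : Subgroup G} (hK : K ≤ H₃) (σ : K →* ℂˣ) :
    (Nat.card H₁ + (Nat.card H₂ - 1)) * Nat.card H₃ ≤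
      Nat.card K * finrank ℂ (eqvRight K σ J) := by
  calc (Nat.card H₁ + (Nat.card H₂ - 1)) * Nat.card H₃
      = Nat.card K * ((Nat.card H₁ + (Nat.card H₂ - 1)) * K.relIndex H₃) := by
        rw [← card_mul_relIndex hK]; ring
    _ ≤ Nat.card K * finrank ℂ (eqvRight K σ J) :=
        Nat.mul_le_mul_left _ (index_mul_le_finrank_eqvRight J hJ htpp hf h1 h0 hK σ)

/-- **Twisted module law for the MIDDLE member:** `|H₁| · [H₂ : K] ≤ dim J_σ` for `K ≤ H₂`
(the law for the degenerate triple `(H₁, 1, H₂)`). -/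
theorem card_mul_index_le_finrank_eqvRight_middle (J : Submodule ℂ (G → ℂ))
    (hJ : ∀ f ∈ J, ∀ s t : G, (fun g => f (s * g * t)) ∈ J)
    {H₁ H₂ H₃ : Subgroup G} (htpp : SubgroupTPP H₁ H₂ H₃)
    {f : G → ℂ} (hf : f ∈ J) (h1 : f 1 = 1)
    (h0 : ∀ a ∈ H₁, ∀ b ∈ H₂, ∀ c ∈ H₃, a * b * c ≠ 1 → f (a * b * c) = 0)
    {K : Subgroup G} (hK : K ≤ H₂) (σ : K →* ℂˣ) :
    Nat.card H₁ * K.relIndex H₂ ≤ finrank ℂ (eqvRight K σ J) := by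
  have h := index_mul_le_finrank_eqvRight J hJ (tpp_drop_middle htpp) hf h1 (test_drop_middle h0)
    hK σ
  have hbot : Nat.card (⊥ : Subgroup G) = 1 := Subgroup.card_bot
  rw [hbot, Nat.sub_self, add_zero] at h
  exact h

/-- Middle form, multiplied out: `|H₁| · |H₂| ≤ |K| · dim J_σ` for `K ≤ H₂`. -/
theorem card_mul_card_le_finrank_eqvRight_middle (J : Submodule ℂ (G → ℂ))
    (hJ : ∀ f ∈ J, ∀ s t : G, (fun g => f (s * g * t)) ∈ J)
    {H₁ H₂ H₃ : Subgroup G} (htpp : SubgroupTPP H₁ H₂ H₃)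
    {f : G → ℂ} (hf : f ∈ J) (h1 : f 1 = 1)
    (h0 : ∀ a ∈ H₁, ∀ b ∈ H₂, ∀ c ∈ H₃, a * b * c ≠ 1 → f (a * b * c) = 0)
    {K : Subgroup G} (hK : K ≤ H₂) (σ : K →* ℂˣ) :
    Nat.card H₁ * Nat.card H₂ ≤ Nat.card K * finrank ℂ (eqvRight K σ J) := by
  calc Nat.card H₁ * Nat.card H₂ = Nat.card K * (Nat.card H₁ * K.relIndex H₂) := by
        rw [← card_mul_relIndex hK]; ring
    _ ≤ Nat.card K * finrank ℂ (eqvRight K σ J) :=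
        Nat.mul_le_mul_left _ (card_mul_index_le_finrank_eqvRight_middle J hJ htpp hf h1 h0 hK σ)

end Abstract

/-! ## Crux form -/

section Crux

open Summit.MatrixMultiplication.MatrixMultiplication.Theorems.LieRankDesigns.Negative (GLm Mat)
open Summit.MatrixMultiplication.MatrixMultiplication.Theorems.LevelOneGL2Designs.Negative
  (levelSubmodule levelSubmodule_bi_inv)
open PackingBridge (exists_test)

variable {p m k : ℕ} [hp : Fact p.Prime]

/-- **TWISTED MODULE LAW FOR THE CRUX (third member).**  For every witness of
`SubgroupIdentityDesigns` (subgroup TPP + the level-`k` identity-design clause verbatim), every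
subgroup `K ≤ H₃` and every linear character `σ : K →* ℂˣ`:
`(|H₁| + |H₂| − 1) · [H₃ : K] ≤ dim (F_k)_σ`. -/
theorem crux_twisted_right {H₁ H₂ H₃ : Subgroup (GLm p m)} (htpp : SubgroupTPP H₁ H₂ H₃)
    (hdes : ∃ c : Mat p m → ℂ, (∀ M, k < M.rank → c M = 0) ∧
      (∑ M, c M * ZMod.stdAddChar (Matrix.trace (M * ((1 : GLm p m) : Mat p m)))) = 1 ∧
      ∀ a ∈ H₁, ∀ b ∈ H₂, ∀ g ∈ H₃, a * b * g ≠ 1 →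
        (∑ M, c M * ZMod.stdAddChar (Matrix.trace (M * ((a * b * g : GLm p m) : Mat p m)))) = 0)
    {K : Subgroup (GLm p m)} (hK : K ≤ H₃) (σ : K →* ℂˣ) :
    (Nat.card H₁ + (Nat.card H₂ - 1)) * K.relIndex H₃ ≤
      finrank ℂ (eqvRight K σ (levelSubmodule p m k)) := by
  obtain ⟨f, hf, h1, h0⟩ := exists_test hdes
  exact index_mul_le_finrank_eqvRight (levelSubmodule p m k) levelSubmodule_bi_inv htpp hf h1 h0
    hK σ

/-- Multiplied-out crux form: `(|H₁| + |H₂| − 1) · |H₃| ≤ |K| · dim (F_k)_σ` for `K ≤ H₃`. -/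
theorem crux_twisted_right' {H₁ H₂ H₃ : Subgroup (GLm p m)} (htpp : SubgroupTPP H₁ H₂ H₃)
    (hdes : ∃ c : Mat p m → ℂ, (∀ M, k < M.rank → c M = 0) ∧
      (∑ M, c M * ZMod.stdAddChar (Matrix.trace (M * ((1 : GLm p m) : Mat p m)))) = 1 ∧
      ∀ a ∈ H₁, ∀ b ∈ H₂, ∀ g ∈ H₃, a * b * g ≠ 1 →
        (∑ M, c M * ZMod.stdAddChar (Matrix.trace (M * ((a * b * g : GLm p m) : Mat p m)))) = 0)
    {K : Subgroup (GLm p m)} (hK : K ≤ H₃) (σ : K →* ℂˣ) :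
    (Nat.card H₁ + (Nat.card H₂ - 1)) * Nat.card H₃ ≤
      Nat.card K * finrank ℂ (eqvRight K σ (levelSubmodule p m k)) := by
  obtain ⟨f, hf, h1, h0⟩ := exists_test hdes
  exact card_mul_le_card_mul_finrank_eqvRight (levelSubmodule p m k) levelSubmodule_bi_inv htpp hf
    h1 h0 hK σ

/-- **TWISTED MODULE LAW FOR THE CRUX (middle member):** `|H₁| · [H₂ : K] ≤ dim (F_k)_σ` for
`K ≤ H₂`. -/
theorem crux_twisted_middle {H₁ H₂ H₃ : Subgroup (GLm p m)} (htpp : SubgroupTPP H₁ H₂ H₃)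
    (hdes : ∃ c : Mat p m → ℂ, (∀ M, k < M.rank → c M = 0) ∧
      (∑ M, c M * ZMod.stdAddChar (Matrix.trace (M * ((1 : GLm p m) : Mat p m)))) = 1 ∧
      ∀ a ∈ H₁, ∀ b ∈ H₂, ∀ g ∈ H₃, a * b * g ≠ 1 →
        (∑ M, c M * ZMod.stdAddChar (Matrix.trace (M * ((a * b * g : GLm p m) : Mat p m)))) = 0)
    {K : Subgroup (GLm p m)} (hK : K ≤ H₂) (σ : K →* ℂˣ) :
    Nat.card H₁ * K.relIndex H₂ ≤ finrank ℂ (eqvRight K σ (levelSubmodule p m k)) := by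
  obtain ⟨f, hf, h1, h0⟩ := exists_test hdes
  exact card_mul_index_le_finrank_eqvRight_middle (levelSubmodule p m k) levelSubmodule_bi_inv
    htpp hf h1 h0 hK σ

/-- Multiplied-out middle crux form: `|H₁| · |H₂| ≤ |K| · dim (F_k)_σ` for `K ≤ H₂`. -/
theorem crux_twisted_middle' {H₁ H₂ H₃ : Subgroup (GLm p m)} (htpp : SubgroupTPP H₁ H₂ H₃)
    (hdes : ∃ c : Mat p m → ℂ, (∀ M, k < M.rank → c M = 0) ∧
      (∑ M, c M * ZMod.stdAddChar (Matrix.trace (M * ((1 : GLm p m) : Mat p m)))) = 1 ∧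
      ∀ a ∈ H₁, ∀ b ∈ H₂, ∀ g ∈ H₃, a * b * g ≠ 1 →
        (∑ M, c M * ZMod.stdAddChar (Matrix.trace (M * ((a * b * g : GLm p m) : Mat p m)))) = 0)
    {K : Subgroup (GLm p m)} (hK : K ≤ H₂) (σ : K →* ℂˣ) :
    Nat.card H₁ * Nat.card H₂ ≤ Nat.card K * finrank ℂ (eqvRight K σ (levelSubmodule p m k)) := by
  obtain ⟨f, hf, h1, h0⟩ := exists_test hdes
  exact card_mul_card_le_finrank_eqvRight_middle (levelSubmodule p m k) levelSubmodule_bi_inv htpp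
    hf h1 h0 hK σ

end Crux

end TwistedModuleLaw
end Summit.MatrixMultiplication.MatrixMultiplication.Theorems.SubgroupIdentityDesigns.Negative

end
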